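import Mathlib
import Literature.Analysis.FluidPDE.SuitableWeak
import Literature.Analysis.FluidPDE.SelfSimilarCollapseAnsatz
import Literature.Analysis.FluidPDE.LocalLeraySlabGoodSlices
import Literature.Analysis.FunctionSpaces.SobolevBallScaling
import Literature.Analysis.FunctionSpaces.SobolevDomainNormProofs
import Summits.NavierStokesRegularity.NavierStokesRegularity.Theorems.EulerZoomLiouvillePowerGaugeEulerLiouvilleSelfSimilarGauges
import Summits.NavierStokesRegularity.NavierStokesRegularity.Theorems.EulerZoomLiouvillePowerGaugeEulerLiouvilleSelfSimilarPressure
import Summits.NavierStokesRegularity.NavierStokesRegularity.Theorems.EulerZoomLiouvillePowerGaugeEulerLiouvilleSelfSimilarGradient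
import HarnessLib

/-!
# Rung C1 of the crux `EulerZoomLiouville.PowerGaugeEulerLiouville`: identification of the weak
# gradient of a self-similar member and the full transfer to a profile Liouville statement

Route №10 `EulerZoomLiouville` (NavierStokesRegularity), crux E = stmt-NavierStokesRegularity-19832,
tenure rung C1 (exactly self-similar members).  Final bookkeeping file of the profile dictionary
(`…SelfSimilarLEI`, `…SelfSimilarGauges`, `…SelfSimilarPressure`, `…SelfSimilarGradient`):

* `exists_profileGradient_ae` — ANY weak spatial gradient `H` of an exactly self-similar member
  `u(τ) = selfSimilarCollapse γ 0 V τ` on the slab is a.e. the self-similar gradient: there is a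
  profile gradient `G` (a weak derivative of `V` on `ℝ³`, a.e.-strongly measurable) with
  `H(τ) = (−τ)^{−1} • G((−τ)^{−γ} ·)` a.e., for a.e. `τ < 0` (slices of weak gradients are weak
  derivatives — tree `ae_hasWeakFDerivOn_slice_slab` —, the affine change of variables
  `HasWeakFDerivOn.comp_affine`, and uniqueness of weak derivatives `HasWeakFDerivOn.unique_holds`);
* `cknE_eq_of_ae_slab` — `cknE` only sees the a.e. class of the gradient on the slab;
* `rungC1_of_profileLiouville_full` — TRANSFER with the complete dictionary: rung C1 at exponent
  `ρ ∈ (0,1)` follows from a Liouville theorem for profile triples `(V, P, G)` (`G` a weak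
  derivative of `V`) carrying the energy growth (`A`), the weighted dissipation bound (`E`), the
  weighted pressure bound (`D`) and the forward profile local energy inequality.

WHAT THIS IS NOT: not NS, not E, not rung C1 — the profile Liouville theorem in the window
remains open (Chae–Shvydkoy's window).
-/

noncomputable section

set_option linter.dupNamespace false

open MeasureTheory Set Filter Topology Metric Function TopologicalSpace
open scoped ENNReal NNReal InnerProductSpace RealInnerProductSpace

namespace Summit.NavierStokesRegularity.NavierStokesRegularity.Theorems.PowerGaugeEulerLiouville

open Literature.Analysis Literature.Analysis.FunctionSpaces Literature.Analysis.FluidPDE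

section Identification

/-- The self-similar space dilation `(τ, x) ↦ (−τ)^{−γ} x` is quasi-measure-preserving from the
slab `(−∞,0) × ℝ³` (product Lebesgue measure) to `ℝ³` (each slice is a dilation). [folklore] -/
theorem quasiMeasurePreserving_selfSimilarDilation (γ : ℝ) :
    Measure.QuasiMeasurePreserving
      (fun z : ℝ × EuclideanSpace ℝ (Fin 3) => (-z.1) ^ (-γ) • z.2)
      (((volume : Measure ℝ).restrict (Iio (0 : ℝ))).prod (volume : Measure (EuclideanSpace ℝ (Fin 3))))
      volume := by
  refine MeasureTheory.QuasiMeasurePreserving.prod_of_right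
    ((measurable_fst.neg.pow_const _).smul measurable_snd) ?_
  filter_upwards [ae_restrict_mem measurableSet_Iio] with τ hτ
  exact quasiMeasurePreserving_smul (Real.rpow_pos_of_pos (neg_pos.2 hτ) _).ne'

/-- `affinePreimage d 0 ⊤ = ⊤`. [folklore] -/
theorem affinePreimage_zero_top (d : ℝ) :
    affinePreimage d (0 : EuclideanSpace ℝ (Fin 3)) (⊤ : Opens (EuclideanSpace ℝ (Fin 3))) = ⊤ := by
  ext y
  simp [coe_affinePreimage]

/-- From a weak derivative of the dilated slice `x ↦ c • V (d • x)` (`c, d > 0`) on `ℝ³` to a weak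
derivative of the profile: `V` has the weak derivative `y ↦ c⁻¹ • d⁻¹ • K (d⁻¹ • y)`. [folklore] -/
theorem hasWeakFDerivOn_profile_of_slice {c d : ℝ} (hc : 0 < c) (hd : 0 < d)
    {V : EuclideanSpace ℝ (Fin 3) → EuclideanSpace ℝ (Fin 3)}
    {K : EuclideanSpace ℝ (Fin 3) → EuclideanSpace ℝ (Fin 3) →L[ℝ] EuclideanSpace ℝ (Fin 3)}
    (h : HasWeakFDerivOn (⊤ : Opens (EuclideanSpace ℝ (Fin 3))) volume (fun x => c • V (d • x)) K) :
    HasWeakFDerivOn (⊤ : Opens (EuclideanSpace ℝ (Fin 3))) volume V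
      (fun y => c⁻¹ • (d⁻¹ • K (d⁻¹ • y))) := by
  have h1 := h.comp_affine (inv_pos.2 hd) (0 : EuclideanSpace ℝ (Fin 3))
  rw [affinePreimage_zero_top] at h1
  have h2 := h1.const_smul c⁻¹
  have e1 : (c⁻¹ • fun y : EuclideanSpace ℝ (Fin 3) => c • V (d • ((0 : EuclideanSpace ℝ (Fin 3)) + d⁻¹ • y))) = V := by
    funext y
    simp only [Pi.smul_apply, zero_add, smul_smul, mul_inv_cancel₀ hd.ne', one_smul,
      inv_mul_cancel₀ hc.ne']
  have e2 : (c⁻¹ • fun y : EuclideanSpace ℝ (Fin 3) => d⁻¹ • K ((0 : EuclideanSpace ℝ (Fin 3)) + d⁻¹ • y)) =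
      fun y => c⁻¹ • (d⁻¹ • K (d⁻¹ • y)) := by
    funext y
    simp only [Pi.smul_apply, zero_add]
  rw [e1, e2] at h2
  exact h2

/-- **Identification of the weak gradient of an exactly self-similar member.**  Let `H` be a
weak spatial gradient on the slab `(−∞,0) × ℝ³` of `u` with `u(τ) = selfSimilarCollapse γ 0 V τ`
(`τ < 0`).  Then there is a profile gradient `G`, a weak derivative of `V` on `ℝ³`, a.e.-strongly
measurable, with `H(τ) = (−τ)^{−1} • G((−τ)^{−γ} ·)` a.e. on `ℝ³` for a.e. `τ < 0` — the weak
form of `∇u(τ, x) = (−τ)^{−1} ∇V((−τ)^{−γ} x)` (tree `fderiv_selfSimilarCollapse`). [folklore] -/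
theorem exists_profileGradient_ae {γ : ℝ}
    {u : ℝ → EuclideanSpace ℝ (Fin 3) → EuclideanSpace ℝ (Fin 3)}
    {H : ℝ → EuclideanSpace ℝ (Fin 3) → EuclideanSpace ℝ (Fin 3) →L[ℝ] EuclideanSpace ℝ (Fin 3)}
    (hH : HasWeakSpatialGradientOn (slab (EuclideanSpace ℝ (Fin 3)) (Iio 0) isOpen_Iio) u H)
    {V : EuclideanSpace ℝ (Fin 3) → EuclideanSpace ℝ (Fin 3)}
    (hu : ∀ τ : ℝ, τ < 0 → u τ = selfSimilarCollapse γ 0 V τ) :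
    ∃ G : EuclideanSpace ℝ (Fin 3) → EuclideanSpace ℝ (Fin 3) →L[ℝ] EuclideanSpace ℝ (Fin 3),
      AEStronglyMeasurable G volume ∧
      HasWeakFDerivOn (⊤ : Opens (EuclideanSpace ℝ (Fin 3))) volume V G ∧
      ∀ᵐ τ ∂((volume : Measure ℝ).restrict (Iio (0 : ℝ))),
        H τ =ᵐ[volume] fun x => (-τ) ^ (-1 : ℝ) • G ((-τ) ^ (-γ) • x) := by
  -- (1) a.e. slice is a weak derivative
  have hslice : ∀ᵐ τ ∂((volume : Measure ℝ).restrict (Iio (0 : ℝ))),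
      HasWeakFDerivOn (⊤ : Opens (EuclideanSpace ℝ (Fin 3))) volume (u τ) (H τ) := by
    have hU : (Iio (0 : ℝ)) = ⋃ n : ℕ, Ioo (-((n : ℝ) + 1)) 0 := by
      refine subset_antisymm (fun t ht => mem_iUnion.2 ?_) (iUnion_subset fun n t ht => ht.2)
      obtain ⟨n, hn⟩ := exists_nat_gt (-t)
      exact ⟨n, ⟨by linarith, ht⟩⟩
    rw [hU, ae_restrict_iUnion_iff]
    intro n
    have hn : HasWeakSpatialGradientOn (slab (EuclideanSpace ℝ (Fin 3)) (Ioo (-((n : ℝ) + 1)) 0) isOpen_Ioo) u H :=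
      hH.mono (slab_mono Ioo_subset_Iio_self)
    exact hn.ae_hasWeakFDerivOn_slice_slab
  -- (2) a.e. slice of `H` is a.e.-strongly measurable; `τ < 0` a.e.
  have hHm : AEStronglyMeasurable (uncurry H)
      (((volume : Measure ℝ).restrict (Iio (0 : ℝ))).prod (volume : Measure (EuclideanSpace ℝ (Fin 3)))) := by
    have := hH.locallyIntegrableOn_grad.aestronglyMeasurable
    rw [coe_slab, Measure.volume_eq_prod, ← Measure.prod_restrict, Measure.restrict_univ] at this
    exact this
  have hmeas : ∀ᵐ τ ∂((volume : Measure ℝ).restrict (Iio (0 : ℝ))),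
      AEStronglyMeasurable (H τ) volume := hHm.prodMk_left
  have hneg : ∀ᵐ τ ∂((volume : Measure ℝ).restrict (Iio (0 : ℝ))), τ < 0 :=
    ae_restrict_mem measurableSet_Iio
  haveI : (ae ((volume : Measure ℝ).restrict (Iio (0 : ℝ)))).NeBot := by
    rw [ae_neBot, Ne, Measure.restrict_eq_zero]
    simp
  obtain ⟨τ₀, ⟨hW₀, hm₀⟩, hτ₀⟩ := ((hslice.and hmeas).and hneg).exists
  -- (3) the profile gradient from the slice at `τ₀`
  have hs₀ : 0 < -τ₀ := neg_pos.2 hτ₀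
  set c₀ : ℝ := (-τ₀) ^ (γ - 1) with hc₀
  set d₀ : ℝ := (-τ₀) ^ (-γ) with hd₀
  have hc₀p : 0 < c₀ := Real.rpow_pos_of_pos hs₀ _
  have hd₀p : 0 < d₀ := Real.rpow_pos_of_pos hs₀ _
  have huslice : ∀ {τ : ℝ}, τ < 0 → u τ = fun x => (-τ) ^ (γ - 1) • V ((-τ) ^ (-γ) • x) := by
    intro τ hτ
    funext x
    rw [hu τ hτ, selfSimilarCollapse_apply, zero_sub]
  set G : EuclideanSpace ℝ (Fin 3) → EuclideanSpace ℝ (Fin 3) →L[ℝ] EuclideanSpace ℝ (Fin 3) :=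
    fun y => c₀⁻¹ • (d₀⁻¹ • H τ₀ (d₀⁻¹ • y)) with hG
  have hVG : HasWeakFDerivOn (⊤ : Opens (EuclideanSpace ℝ (Fin 3))) volume V G := by
    rw [huslice hτ₀] at hW₀
    exact hasWeakFDerivOn_profile_of_slice hc₀p hd₀p hW₀
  have hGm : AEStronglyMeasurable G volume := by
    have h1 : AEStronglyMeasurable (fun y => H τ₀ (d₀⁻¹ • y)) volume :=
      hm₀.comp_quasiMeasurePreserving (quasiMeasurePreserving_smul (inv_pos.2 hd₀p).ne')
    exact (h1.const_smul d₀⁻¹).const_smul c₀⁻¹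
  refine ⟨G, hGm, hVG, ?_⟩
  -- (4) for every good `τ`: uniqueness of the weak derivative of `V`
  filter_upwards [hslice, hneg] with τ hWτ hτ
  have hs : 0 < -τ := neg_pos.2 hτ
  set c : ℝ := (-τ) ^ (γ - 1) with hcdef
  set d : ℝ := (-τ) ^ (-γ) with hddef
  have hcp : 0 < c := Real.rpow_pos_of_pos hs _
  have hdp : 0 < d := Real.rpow_pos_of_pos hs _
  rw [huslice hτ] at hWτ
  have hVG' := hasWeakFDerivOn_profile_of_slice hcp hdp hWτ
  have huniq := HasWeakFDerivOn.unique_holds hVG' hVG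
  rw [Opens.coe_top, Measure.restrict_univ] at huniq
  -- transport `y = d • x`
  have ht := (quasiMeasurePreserving_smul hdp.ne').ae_eq_comp huniq
  filter_upwards [ht] with x hx
  simp only [comp_apply, smul_smul, inv_mul_cancel₀ hdp.ne', one_smul] at hx
  -- `hx : c⁻¹ • (d⁻¹ • H τ x) = G (d • x)`
  have hcd : c * d = (-τ) ^ (-1 : ℝ) := by
    rw [hcdef, hddef, ← Real.rpow_add hs]
    congr 1; ring
  calc H τ x = (c * d) • ((c⁻¹ * d⁻¹) • H τ x) := by
        rw [smul_smul, show c * d * (c⁻¹ * d⁻¹) = 1 by field_simp, one_smul]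
    _ = (-τ) ^ (-1 : ℝ) • G ((-τ) ^ (-γ) • x) := by rw [hx, hcd]

end Identification

/-! ## The weak gradient of a self-similar member is a.e. the self-similar gradient (slab form) -/

section SlabForm

/-- Two a.e.-strongly measurable functions on a product that agree a.e. on a.e. slice agree a.e.
[folklore] -/
theorem ae_eq_prod_of_ae_ae_eq {α β X : Type*} [MeasurableSpace α] [MeasurableSpace β]
    [TopologicalSpace X] [MetrizableSpace X] {μ : Measure α} {ν : Measure β} [SFinite ν]
    {f g : α × β → X} (hf : AEStronglyMeasurable f (μ.prod ν)) (hg : AEStronglyMeasurable g (μ.prod ν))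
    (h : ∀ᵐ a ∂μ, (fun b => f (a, b)) =ᵐ[ν] fun b => g (a, b)) :
    f =ᵐ[μ.prod ν] g := by
  have hS : MeasurableSet {z : α × β | hf.mk f z = hg.mk g z} :=
    hf.stronglyMeasurable_mk.measurableSet_eq_fun hg.stronglyMeasurable_mk
  have h1 := Measure.ae_ae_of_ae_prod hf.ae_eq_mk
  have h2 := Measure.ae_ae_of_ae_prod hg.ae_eq_mk
  have h3 : ∀ᵐ a ∂μ, ∀ᵐ b ∂ν, (a, b) ∈ {z : α × β | hf.mk f z = hg.mk g z} := by
    filter_upwards [h, h1, h2] with a ha h1a h2a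
    filter_upwards [ha, h1a, h2a] with b hb h1b h2b
    simp only [← h1b, ← h2b, hb]
  have h4 := (Measure.ae_prod_mem_iff_ae_ae_mem hS).2 h3
  filter_upwards [hf.ae_eq_mk, hg.ae_eq_mk, h4] with z hz1 hz2 hz
  rw [hz1, hz2]; exact hz

/-- `cknE` at a cylinder `Q_a(0, x₀)` below time `0` only sees the a.e. class of the gradient on
the slab `(−∞,0) × ℝ³`. [folklore] -/
theorem cknE_congr_ae_slab
    {H H' : ℝ → EuclideanSpace ℝ (Fin 3) → EuclideanSpace ℝ (Fin 3) →L[ℝ] EuclideanSpace ℝ (Fin 3)}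
    (h : uncurry H =ᵐ[volume.restrict (Iio (0 : ℝ) ×ˢ (univ : Set (EuclideanSpace ℝ (Fin 3))))] uncurry H')
    (a : ℝ) (x₀ : EuclideanSpace ℝ (Fin 3)) :
    cknE a ((0 : ℝ), x₀) H = cknE a ((0 : ℝ), x₀) H' := by
  unfold cknE
  congr 1
  have hsub : parabolicCylinder a ((0 : ℝ), x₀) ⊆ Iio (0 : ℝ) ×ˢ (univ : Set (EuclideanSpace ℝ (Fin 3))) := by
    rintro ⟨t, x⟩ hz
    rw [mem_parabolicCylinder] at hz
    exact mem_prod.2 ⟨hz.1.2, mem_univ _⟩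
  refine lintegral_congr_ae ?_
  filter_upwards [ae_restrict_of_ae_restrict_of_subset hsub h] with z hz
  rw [show H z.1 z.2 = uncurry H z from rfl, show H' z.1 z.2 = uncurry H' z from rfl, hz]

end SlabForm

/-! ## The full transfer -/

section Transfer

/-- **TRANSFER with the complete profile dictionary.**  Suppose that every profile triple
`(V, P, G)` on `ℝ³` — `V`, `P`, `G` a.e.-strongly measurable, `G` a weak derivative of `V` on
`ℝ³` — which carries, for some `c ≥ 0`,
(A) the energy growth `∫_{B_L} ‖V‖² ≤ c L^{1−2ρ}` (`L > 0`),
(E) the weighted dissipation bound `∫ |G|²_F |y|^{ρ−1} ≤ ((1−ρ)/(2+ρ)) c`,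
(D) the weighted pressure bound `∫ |P|^{3/2} |y|^{2ρ−2} ≤ ((2−2ρ)/(2+ρ)) c`, and
(LEI) the forward profile local energy inequality of `selfSimilar_profile_energy_le_add_flux`,
has `V = 0` a.e.  Then every EXACTLY SELF-SIMILAR member (exponent `γ = 1/(2+ρ)`, `0 < ρ < 1`) of
the power-gauged ancient Euler class with exponent `ρ` — the hypotheses of the route crux
`EulerZoomLiouville.PowerGaugeEulerLiouville` — vanishes a.e. on the slab (the tenure kit's
`Sig.rungC1_selfSimilar` at `ρ`, via the bridges of `…SelfSimilarGauges`).  This is the honest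
profile-space form of rung C1: in the window `0 < ρ ≤ 1/2` the profile Liouville theorem is the
open Chae–Shvydkoy window (`α = 1+ρ`); at the endpoint `ρ = 1/2` its hypotheses read
`V ∈ L²`, `∫|∇V|²|y|^{−1/2} ≤ c/5`, `∫|P|^{3/2}|y|^{−1} ≤ 2c/5` + forward LEI. [cite: ChaeShvydkoy2013, §3.1 Thm. 3.1 and §2.2 eq. (2.9)] -/
theorem rungC1_of_profileLiouville_full {ρ : ℝ} (hρ : 0 < ρ) (hρ1 : ρ < 1)
    (hLiouville : ∀ (V : EuclideanSpace ℝ (Fin 3) → EuclideanSpace ℝ (Fin 3))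
        (P : EuclideanSpace ℝ (Fin 3) → ℝ)
        (G : EuclideanSpace ℝ (Fin 3) → EuclideanSpace ℝ (Fin 3) →L[ℝ] EuclideanSpace ℝ (Fin 3)) (c : ℝ≥0),
      AEStronglyMeasurable V volume → AEStronglyMeasurable P volume → AEStronglyMeasurable G volume →
      HasWeakFDerivOn (⊤ : Opens (EuclideanSpace ℝ (Fin 3))) volume V G →
      (∀ L : ℝ, 0 < L → ∫⁻ y in ball (0 : EuclideanSpace ℝ (Fin 3)) L, ‖V y‖ₑ ^ 2 ≤
        (c : ℝ≥0∞) * ENNReal.ofReal (L ^ (1 - 2 * ρ))) →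
      (∫⁻ y, ENNReal.ofReal (frobeniusNormSq (G y)) * ENNReal.ofReal (‖y‖ ^ (ρ - 1)) ≤
        ENNReal.ofReal ((1 - ρ) / (2 + ρ)) * (c : ℝ≥0∞)) →
      (∫⁻ y, ‖P y‖ₑ ^ (3 / 2 : ℝ) * ENNReal.ofReal (‖y‖ ^ (2 * ρ - 2)) ≤
        ENNReal.ofReal ((2 - 2 * ρ) / (2 + ρ)) * (c : ℝ≥0∞)) →
      (∀ σ : EuclideanSpace ℝ (Fin 3) → ℝ, ContDiff ℝ (⊤ : ℕ∞) σ → HasCompactSupport σ →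
        (∀ x, 0 ≤ σ x) →
        ∀ᵐ τ₁ : ℝ, τ₁ < 0 → ∀ᵐ τ₂ : ℝ, τ₂ ∈ Ioo τ₁ 0 →
          (-τ₂) ^ (5 * (1 / (2 + ρ)) - 2) * ∫ y, ‖V y‖ ^ 2 * σ ((-τ₂) ^ (1 / (2 + ρ)) • y) ≤
            ((-τ₁) ^ (5 * (1 / (2 + ρ)) - 2) * ∫ y, ‖V y‖ ^ 2 * σ ((-τ₁) ^ (1 / (2 + ρ)) • y)) +
              ∫ τ in Ico τ₁ τ₂, (-τ) ^ (6 * (1 / (2 + ρ)) - 3) *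
                ∫ y, (‖V y‖ ^ 2 + 2 * P y) * ⟪V y, gradient σ ((-τ) ^ (1 / (2 + ρ)) • y)⟫) →
      V =ᵐ[volume] 0)
    (u : ℝ → EuclideanSpace ℝ (Fin 3) → EuclideanSpace ℝ (Fin 3))
    (p : ℝ → EuclideanSpace ℝ (Fin 3) → ℝ)
    (H : ℝ → EuclideanSpace ℝ (Fin 3) → EuclideanSpace ℝ (Fin 3) →L[ℝ] EuclideanSpace ℝ (Fin 3))
    (c : ℝ≥0) (V : EuclideanSpace ℝ (Fin 3) → EuclideanSpace ℝ (Fin 3))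
    (P : EuclideanSpace ℝ (Fin 3) → ℝ)
    (hsw : IsSuitableWeakSolutionOn (slab (EuclideanSpace ℝ (Fin 3)) (Iio 0) isOpen_Iio) 0 0 u p)
    (hH : HasWeakSpatialGradientOn (slab (EuclideanSpace ℝ (Fin 3)) (Iio 0) isOpen_Iio) u H)
    (hgauge : ∀ a : ℝ, 0 < a →
      ENNReal.ofReal (a ^ (2 * ρ)) * cknA a (0 : ℝ × EuclideanSpace ℝ (Fin 3)) u +
          ENNReal.ofReal (a ^ ρ) * cknE a (0 : ℝ × EuclideanSpace ℝ (Fin 3)) H +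
        ENNReal.ofReal (a ^ (2 * ρ)) * cknD a (0 : ℝ × EuclideanSpace ℝ (Fin 3)) p ≤ (c : ℝ≥0∞))
    (hu : ∀ τ : ℝ, τ < 0 → u τ = selfSimilarCollapse (1 / (2 + ρ)) 0 V τ)
    (hp : ∀ τ : ℝ, τ < 0 → p τ = selfSimilarCollapsePressure (1 / (2 + ρ)) 0 P τ) :
    uncurry u =ᵐ[volume.restrict (Iio (0 : ℝ) ×ˢ (univ : Set (EuclideanSpace ℝ (Fin 3))))] 0 := by
  -- the three gauges separately
  have hA : ∀ a : ℝ, 0 < a → ENNReal.ofReal (a ^ (2 * ρ)) *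
      cknA a (0 : ℝ × EuclideanSpace ℝ (Fin 3)) u ≤ (c : ℝ≥0∞) :=
    fun a ha => le_trans (le_trans le_self_add le_self_add) (hgauge a ha)
  have hE : ∀ a : ℝ, 0 < a → ENNReal.ofReal (a ^ ρ) *
      cknE a (0 : ℝ × EuclideanSpace ℝ (Fin 3)) H ≤ (c : ℝ≥0∞) :=
    fun a ha => le_trans (le_trans le_add_self le_self_add) (hgauge a ha)
  have hD : ∀ a : ℝ, 0 < a → ENNReal.ofReal (a ^ (2 * ρ)) *
      cknD a (0 : ℝ × EuclideanSpace ℝ (Fin 3)) p ≤ (c : ℝ≥0∞) :=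
    fun a ha => le_trans le_add_self (hgauge a ha)
  -- measurability of `u`, `p`, `H` on the slab (class)
  have hum : AEStronglyMeasurable (uncurry u)
      (volume.restrict (Iio (0 : ℝ) ×ˢ (univ : Set (EuclideanSpace ℝ (Fin 3))))) := by
    have := hH.locallyIntegrableOn.aestronglyMeasurable
    simpa [slab] using this
  have hpm : AEStronglyMeasurable (uncurry p)
      (volume.restrict (Iio (0 : ℝ) ×ˢ (univ : Set (EuclideanSpace ℝ (Fin 3))))) := by
    have := hsw.distributional.2.2.1.aestronglyMeasurable
    simpa [slab] using this
  have hHm : AEStronglyMeasurable (uncurry H)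
      (volume.restrict (Iio (0 : ℝ) ×ˢ (univ : Set (EuclideanSpace ℝ (Fin 3))))) := by
    have := hH.locallyIntegrableOn_grad.aestronglyMeasurable
    simpa [slab] using this
  have hVm := aestronglyMeasurable_profile hum hu
  have hPm := aestronglyMeasurable_pressureProfile hpm hp
  -- the profile gradient and the self-similar representative of `H`
  obtain ⟨G, hGm, hVG, hHae⟩ := exists_profileGradient_ae hH hu
  set Hss : ℝ → EuclideanSpace ℝ (Fin 3) → EuclideanSpace ℝ (Fin 3) →L[ℝ] EuclideanSpace ℝ (Fin 3) :=
    fun τ x => (-τ) ^ (-1 : ℝ) • G ((-τ) ^ (-(1 / (2 + ρ))) • x) with hHss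
  have hHssm' : AEStronglyMeasurable (uncurry Hss)
      (((volume : Measure ℝ).restrict (Iio (0 : ℝ))).prod (volume : Measure (EuclideanSpace ℝ (Fin 3)))) := by
    have h1 : AEStronglyMeasurable (fun z : ℝ × EuclideanSpace ℝ (Fin 3) => G ((-z.1) ^ (-(1 / (2 + ρ))) • z.2))
        (((volume : Measure ℝ).restrict (Iio (0 : ℝ))).prod (volume : Measure (EuclideanSpace ℝ (Fin 3)))) :=
      hGm.comp_quasiMeasurePreserving (quasiMeasurePreserving_selfSimilarDilation (1 / (2 + ρ)))
    have h2 : AEStronglyMeasurable (fun z : ℝ × EuclideanSpace ℝ (Fin 3) => (-z.1) ^ (-1 : ℝ))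
        (((volume : Measure ℝ).restrict (Iio (0 : ℝ))).prod (volume : Measure (EuclideanSpace ℝ (Fin 3)))) :=
      (measurable_fst.neg.pow_const _).aestronglyMeasurable
    exact h2.smul h1
  have hHm' : AEStronglyMeasurable (uncurry H)
      (((volume : Measure ℝ).restrict (Iio (0 : ℝ))).prod (volume : Measure (EuclideanSpace ℝ (Fin 3)))) := by
    rw [Measure.volume_eq_prod, ← Measure.prod_restrict, Measure.restrict_univ] at hHm
    exact hHm
  have hprod' : uncurry H =ᵐ[((volume : Measure ℝ).restrict (Iio (0 : ℝ))).prod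
      (volume : Measure (EuclideanSpace ℝ (Fin 3)))] uncurry Hss :=
    ae_eq_prod_of_ae_ae_eq hHm' hHssm' hHae
  have hprod : uncurry H =ᵐ[volume.restrict (Iio (0 : ℝ) ×ˢ (univ : Set (EuclideanSpace ℝ (Fin 3))))]
      uncurry Hss := by
    rw [Measure.volume_eq_prod, ← Measure.prod_restrict, Measure.restrict_univ]
    exact hprod'
  have hHssm : AEStronglyMeasurable (uncurry Hss)
      (volume.restrict (Iio (0 : ℝ) ×ˢ (univ : Set (EuclideanSpace ℝ (Fin 3))))) := by
    rw [Measure.volume_eq_prod, ← Measure.prod_restrict, Measure.restrict_univ]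
    exact hHssm'
  -- the `E`-gauge passes to the representative
  have hEss : ∀ a : ℝ, 0 < a → ENNReal.ofReal (a ^ ρ) *
      cknE a (0 : ℝ × EuclideanSpace ℝ (Fin 3)) Hss ≤ (c : ℝ≥0∞) := by
    intro a ha
    have := cknE_congr_ae_slab hprod a 0
    rw [show ((0 : ℝ), (0 : EuclideanSpace ℝ (Fin 3))) = (0 : ℝ × EuclideanSpace ℝ (Fin 3)) from rfl] at this
    rw [← this]
    exact hE a ha
  -- the profile-side bounds
  have hgrowth := profile_energy_growth_of_gaugeA hρ hu hA
  have hEprof := profile_gradient_weight_of_gaugeE hρ hρ1 hHssm (fun τ _ => rfl) hEss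
  have hDprof := profile_pressure_weight_of_gaugeD hρ hρ1 hpm hp hD
  have hV0 : V =ᵐ[volume] 0 :=
    hLiouville V P G c hVm hPm hGm hVG hgrowth hEprof hDprof fun σ hσ hσc hσ0 =>
      selfSimilar_profile_energy_le_add_flux hsw hu hp hσ hσc hσ0
  exact selfSimilar_ae_eq_zero_of_profile hum hu hV0

end Transfer

end Summit.NavierStokesRegularity.NavierStokesRegularity.Theorems.PowerGaugeEulerLiouville
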